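import Literature.Analysis.FluidPDE.OnsagerBDSVIncrementLeibniz
import Literature.Analysis.FluidPDE.OnsagerBDSVEnergy
import Literature.Analysis.FluidPDE.OnsagerBDSVPerturbationTildeR
import HarnessLib

/-!
# The BDSV perturbation: the curl of the potential — fast part `= n w_o`, slow part `= n w_c`

Buckmaster–De Lellis–Székelyhidi–Vicol (BDSV), *Onsager's conjecture for admissible weak
solutions*, CPAM 72 (2019) = arXiv:1701.08678, §5.3. The perturbation is given in curl form
(arXiv (5.28) = `BDSV.perturbation`): `w_{q+1} = n⁻¹ curl Z`, `Z = ∑ᵢ ρ_{q,i}^{1/2} ∇Φᵢᵀ V(R̃_{q,i}, nΦᵢ)`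
(`n = n_{q+1}`, `λ_{q+1} = 2πn`), and is split as `w_{q+1} = w_o + w_c` with the principal part
(5.20) `w_o = ∑ᵢ ρ_{q,i}^{1/2} ∇Φᵢ⁻¹ W(R̃_{q,i}, nΦᵢ)` and the corrector (5.27)
`w_c = n⁻¹ ∑ ∇(ρ_{q,i}^{1/2} a_k(R̃_{q,i})) × ∇Φᵢᵀ(…) e^{ik·nΦᵢ}` — "one can check that
`w_{q+1} = w_o + w_c`" through the identity `curl(∇Φᵀ U(Φ)) = cof ∇Φᵀ (curl U)(Φ)` [DaSz2016] and
`curl_ξ V = W` (5.9). The tree DEFINES `w_c := w_{q+1} - w_o` (`BDSV.correctorPart`,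
`OnsagerBDSVEnergy.lean`, with `adj ∇Φᵢ` for `∇Φᵢ⁻¹`); this file PROVES the computation behind
"one can check", in the form needed to ESTIMATE `w_c` (Cor. 5.8 (5.30), and through it the
corrector term of the energy, `BDSV.energy_correctorTerm`):

* `BDSV.curlCLM_conj`: the pull-back identity at the level of Jacobians,
  `curl[∇Φᵀ J ∇Φ] = adj(∇Φ) curl[J]` for every `3 × 3` matrix `∇Φ` and Jacobian `J`
  (`curl[J]` = `BDSV.curlCLM J`; no determinant condition is needed);
* `BDSV.hasFDerivAt_summandCL`: the derivative of the lifted summand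
  `y ↦ (ση(y)) ∇Φ(y)ᵀ V(R̃(y), n(y + D(y)))` (`BDSV.summandCL`, `OnsagerBDSVIncrementLeibniz.lean`) is
  `BDSV.fastDeriv + BDSV.slowDeriv`: the FAST part `n (ση) ∇Φᵀ ∘ D_ξV(R̃, ξ) ∘ ∇Φ` (the chain rule
  through the phase `ξ = n(y + D)`, `Dξ = n∇Φ`) and the SLOW part (derivatives falling on `η`, on
  `∇Φ` and on the matrix argument `R̃`), cf. (5.27);
* `BDSV.curlCLM_fastDeriv`: `curl[fast part] = n (ση) adj(∇Φ) (curl_ξ V)(R̃, ξ)`, which is `n` times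
  the summand of `w_o` once `curl_ξ V = W` (on the Mikado ball, `BDSV.MikadoDatum.curl_V`);
* `BDSV.norm_slowDeriv_le`: `‖slow part‖ ≤ σ ‖T‖ C_V (2‖DR̃‖ + ‖D²(lift D)‖ + 2‖Dη‖)` under
  `|η| ≤ 1`, `‖D(lift D)‖ ≤ 1`, `‖V‖, ‖DV‖ ≤ C_V` at the point (`T = BDSV.transposeCL`), and
  `BDSV.slowDeriv_eq_zero`: the slow part vanishes where `η = 0` (there `Dη = 0` too, `η ≥ 0` being
  minimal: `BDSV.fderiv_lift_eq_zero_of_nonneg`);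
* on the torus (`BDSV.curl_potentialSummand_proj`, `BDSV.correctorPart_proj`): for smooth slices,
  `curl(ρ_{q,i}^{1/2} ∇Φᵢᵀ V(R̃_{q,i}, nΦᵢ))(x) = n · (ρ_{q,i}^{1/2} adj∇Φᵢ W(R̃_{q,i}, nΦᵢ))(x) + curl[slow partᵢ]`
  whenever `R̃_{q,i}(x)` lies in the Mikado ball where `ηᵢ(x) ≠ 0` (Lemma 5.4), hence
  **`w_c(x) = n⁻¹ ∑ᵢ curl[slow partᵢ]`** — the tree's rendering of (5.27).

## References

* T. Buckmaster, C. De Lellis, L. Székelyhidi Jr., V. Vicol, *Onsager's conjecture for admissible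
  weak solutions*, Comm. Pure Appl. Math. 72 (2019) 229–274 = arXiv:1701.08678, §5.3
  (5.20), (5.26)–(5.28) and the identity `curl(∇Φᵀ U(Φ)) = cof ∇Φᵀ (curl U)(Φ)`; §5.1 (5.9);
  Cor. 5.8 (5.30).
* S. Daneri, L. Székelyhidi Jr., *Non-uniqueness and h-principle for Hölder-continuous weak
  solutions of the Euler equations*, ARMA 224 (2017) = arXiv:1603.09714 (the pull-back identity).
-/

open MeasureTheory Set
open scoped NNReal ENNReal ContDiff Matrix Matrix.Norms.Elementwise

noncomputable section

namespace Literature.Analysis.FluidPDE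

namespace BDSV

open FunctionSpaces FunctionSpaces.Torus

/-- The flat three-torus `T³ = (ℝ/ℤ)³`, local notation. -/
local notation "𝕋³" => UnitAddTorus (Fin 3)

/-- Euclidean `ℝ³`, local notation. -/
local notation "ℝ³" => EuclideanSpace ℝ (Fin 3)

/-- Real `3 × 3` matrices, local notation. -/
local notation "𝕄" => Matrix (Fin 3) (Fin 3) ℝ

/-- Continuous linear endomorphisms of `ℝ³`, local notation. -/
local notation "𝕃" => (EuclideanSpace ℝ (Fin 3) →L[ℝ] EuclideanSpace ℝ (Fin 3))

/-! ## The curl of a conjugated Jacobian -/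

section CurlAlgebra

/-- The curl read off a Jacobian matrix `A` (`A i j = ∂ⱼ vᵢ`):
`(A₂₁ - A₁₂, A₀₂ - A₂₀, A₁₀ - A₀₁)`. [folklore] -/
def curlOfMatrix (A : 𝕄) : ℝ³ :=
  WithLp.toLp 2 ![A 2 1 - A 1 2, A 0 2 - A 2 0, A 1 0 - A 0 1]

/-- `BDSV.curlCLM` of the endomorphism with matrix `A` is `curlOfMatrix A`. [folklore] -/
theorem curlCLM_matCL (A : 𝕄) : curlCLM (matCL A) = curlOfMatrix A := by
  ext i
  fin_cases i <;> simp [curlCLM, curlOfMatrix, matCL_apply, Matrix.toLpLin_apply]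

/-- **The pull-back identity for Jacobians** (the algebra behind
`curl(∇Φᵀ U∘Φ) = cof ∇Φᵀ (curl U)∘Φ`): `curl[Gᵀ J G] = adj(G) curl[J]` for all `3 × 3` matrices
`G, J` (`εᵢⱼₖ G_{bj} G_{ak} = adj(G)ᵢₘ ε_{mba}`, the cross product of two columns).
[cite: BuckmasterEtAl2018, §5.3 (identity before (5.28))] -/
theorem curlOfMatrix_conj (G J : 𝕄) :
    curlOfMatrix (Gᵀ * J * G) = Matrix.toEuclideanLin G.adjugate (curlOfMatrix J) := by
  ext i
  fin_cases i <;>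
    simp [curlOfMatrix, Matrix.toLpLin_apply, Fin.sum_univ_three, Matrix.mul_apply,
      Matrix.transpose_apply, Matrix.adjugate_fin_three] <;> ring

/-- **The pull-back identity in the carrier `𝕃`**: for a matrix `G` and an endomorphism `L`
(the Jacobian of a field at a point), `curl[Gᵀ ∘ L ∘ G] = adj(G) curl[L]`.
[cite: BuckmasterEtAl2018, §5.3 (identity before (5.28))] -/
theorem curlCLM_conj (G : 𝕄) (L : 𝕃) :
    curlCLM (matCL Gᵀ * L * matCL G) = Matrix.toEuclideanLin G.adjugate (curlCLM L) := by
  obtain ⟨J, rfl⟩ : ∃ J, L = matCL J := ⟨matCL.symm L, (matCL.apply_symm_apply L).symm⟩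
  rw [← map_mul, ← map_mul, curlCLM_matCL, curlCLM_matCL, curlOfMatrix_conj]

/-- `∇Φ` in the carrier is the matrix `liftGradPhi`: `gradPhiCL D y = matCL (liftGradPhi D y)`. [folklore] -/
theorem gradPhiCL_eq_matCL (Dsl : 𝕋³ → ℝ³) (y : ℝ³) : gradPhiCL Dsl y = matCL (liftGradPhi Dsl y) := by
  rw [← matCL_symm_gradPhiCL, matCL.apply_symm_apply]

end CurlAlgebra

/-! ## The derivative of the lifted summand: fast and slow parts -/

section Derivative

variable (V : 𝕄 → 𝕋³ → ℝ³) (σ c n : ℝ) (ηsl : 𝕋³ → ℝ) (Rsl : 𝕋³ → Fin 3 → ℝ³) (Dsl : 𝕋³ → ℝ³)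

/-- **The fast part of `D(summand)`**: `n (ση(y)) ∇Φ(y)ᵀ ∘ D_ξ[V(R̃(y), ·)](ξ(y)) ∘ ∇Φ(y)`,
`ξ(y) = n(y + D(y))` — the derivative falling on the phase (`Dξ = n∇Φ`), which carries the factor
`n ∼ λ_{q+1}` and produces `w_o` under the curl. [cite: BuckmasterEtAl2018, §5.3 (5.20), (5.28)] -/
def fastDeriv (y : ℝ³) : 𝕃 :=
  (n * (σ * lift ηsl y)) •
    (transposeCL (gradPhiCL Dsl y) *
      fderiv ℝ (lift (V (matCL.symm (stressCL c Rsl Dsl y)))) (n • (y + lift Dsl y)) * gradPhiCL Dsl y)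

/-- **The slow part of `D(summand)`**: the derivatives falling on the matrix argument `R̃`, on the
factor `∇Φᵀ` and on the amplitude `ση` — the terms of the corrector (5.27) (times `n`).
[cite: BuckmasterEtAl2018, §5.3 (5.27)] -/
def slowDeriv (y : ℝ³) : 𝕃 :=
  (σ * lift ηsl y) •
      (transposeCL (gradPhiCL Dsl y) *
          (fderiv ℝ (mikadoLiftCL V) (stressCL c Rsl Dsl y, n • (y + lift Dsl y))).comp
            ((ContinuousLinearMap.inl ℝ 𝕃 ℝ³).comp (fderiv ℝ (stressCL c Rsl Dsl) y)) +
        (transposeCL.comp (fderiv ℝ (fderiv ℝ (lift Dsl)) y)).flip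
          (mikadoLiftCL V (stressCL c Rsl Dsl y, n • (y + lift Dsl y)))) +
    (σ • fderiv ℝ (lift ηsl) y).smulRight
      (transposeCL (gradPhiCL Dsl y) (mikadoLiftCL V (stressCL c Rsl Dsl y, n • (y + lift Dsl y))))

variable {V σ c n ηsl Rsl Dsl}

/-- For a smooth Mikado lift, each profile `V(R, ·)` is smooth on the torus. [folklore] -/
theorem isSmooth_of_mikadoLift (hV : ContDiff ℝ ∞ (mikadoLift V)) (R : 𝕄) : IsSmooth (V R) :=
  hV.comp (contDiff_const.prodMk contDiff_id)

/-- The partial derivative of the carrier lift in the fast variable is the derivative of the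
periodic lift of the profile: `D(mikadoLiftCL V)(S, ξ) ∘ inr = D(lift V(matCL⁻¹S))(ξ)`. [folklore] -/
theorem fderiv_mikadoLiftCL_comp_inr (hV : ContDiff ℝ ∞ (mikadoLift V)) (T : 𝕃) (ξ : ℝ³) :
    (fderiv ℝ (mikadoLiftCL V) (T, ξ)).comp (ContinuousLinearMap.inr ℝ 𝕃 ℝ³) =
      fderiv ℝ (lift (V (matCL.symm T))) ξ := by
  have hM : HasFDerivAt (mikadoLiftCL V) (fderiv ℝ (mikadoLiftCL V) (T, ξ)) (T, ξ) :=
    (((contDiff_mikadoLiftCL hV).differentiable (by simp)) _).hasFDerivAt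
  have h : HasFDerivAt (fun ζ : ℝ³ => mikadoLiftCL V (T, ζ))
      ((fderiv ℝ (mikadoLiftCL V) (T, ξ)).comp (ContinuousLinearMap.inr ℝ 𝕃 ℝ³)) ξ :=
    hM.comp ξ (hasFDerivAt_prodMk_right T ξ)
  rw [← h.fderiv]
  rfl

/-- `∇Φ = Id + D(lift D)` has derivative `D²(lift D)`. [folklore] -/
theorem hasFDerivAt_gradPhiCL (hD : IsSmooth Dsl) (y : ℝ³) :
    HasFDerivAt (gradPhiCL Dsl) (fderiv ℝ (fderiv ℝ (lift Dsl)) y) y := by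
  have hD' : ContDiff ℝ ∞ (lift Dsl) := hD
  have h1 : HasFDerivAt (fderiv ℝ (lift Dsl)) (fderiv ℝ (fderiv ℝ (lift Dsl)) y) y :=
    (((hD'.fderiv_right (m := ∞) le_rfl).differentiable (by simp)) y).hasFDerivAt
  exact h1.const_add (1 : 𝕃)

/-- The phase `ξ(y) = n(y + D(y))` has derivative `n ∇Φ(y)`. [folklore] -/
theorem hasFDerivAt_phase (hD : IsSmooth Dsl) (y : ℝ³) :
    HasFDerivAt (fun z : ℝ³ => n • (z + lift Dsl z)) (n • gradPhiCL Dsl y) y := by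
  have hD' : ContDiff ℝ ∞ (lift Dsl) := hD
  have h1 : HasFDerivAt (fun z : ℝ³ => z + lift Dsl z)
      (ContinuousLinearMap.id ℝ ℝ³ + fderiv ℝ (lift Dsl) y) y :=
    (hasFDerivAt_id y).add ((hD'.differentiable (by simp)) y).hasFDerivAt
  have h2 : ContinuousLinearMap.id ℝ ℝ³ + fderiv ℝ (lift Dsl) y = gradPhiCL Dsl y := by
    rw [gradPhiCL, ContinuousLinearMap.one_def]
  rw [← h2]
  exact h1.const_smul n

/-- **The derivative of the lifted potential summand** `y ↦ (ση(y)) ∇Φ(y)ᵀ V(R̃(y), n(y + D(y)))`: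
`D(summand) = fastDeriv + slowDeriv` (chain rule through the pair `(R̃, ξ)`, product rules for
the factors `∇Φᵀ` and `ση`). [cite: BuckmasterEtAl2018, §5.3 (5.26)–(5.28)] -/
theorem hasFDerivAt_summandCL (hV : ContDiff ℝ ∞ (mikadoLift V)) (hη : IsSmooth ηsl)
    (hR : IsSmooth Rsl) (hD : IsSmooth Dsl) (y : ℝ³) :
    HasFDerivAt (summandCL V σ c n ηsl Rsl Dsl)
      (fastDeriv V σ c n ηsl Rsl Dsl y + slowDeriv V σ c n ηsl Rsl Dsl y) y := by
  have hη' : ContDiff ℝ ∞ (lift ηsl) := hη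
  set M := mikadoLiftCL V with hMdef
  set T := stressCL c Rsl Dsl with hTdef
  set p : 𝕃 × ℝ³ := (T y, n • (y + lift Dsl y)) with hpdef
  -- the factors
  have hG := hasFDerivAt_gradPhiCL hD y
  have hA : HasFDerivAt (fun z => transposeCL (gradPhiCL Dsl z))
      (transposeCL.comp (fderiv ℝ (fderiv ℝ (lift Dsl)) y)) y := transposeCL.hasFDerivAt.comp y hG
  have hT : HasFDerivAt T (fderiv ℝ T y) y :=
    (((contDiff_stressCL c hR hD).differentiable (by simp)) y).hasFDerivAt
  have hξ := hasFDerivAt_phase (n := n) hD y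
  have hp : HasFDerivAt (fun z => (T z, n • (z + lift Dsl z)))
      ((fderiv ℝ T y).prod (n • gradPhiCL Dsl y)) y := hT.prodMk hξ
  have hM : HasFDerivAt M (fderiv ℝ M p) p :=
    (((contDiff_mikadoLiftCL hV).differentiable (by simp)) p).hasFDerivAt
  have hMp' := hM.comp y hp
  have hMp : HasFDerivAt (fun z => M (T z, n • (z + lift Dsl z)))
      ((fderiv ℝ M p).comp ((fderiv ℝ T y).prod (n • gradPhiCL Dsl y))) y := hMp'
  have hu := hA.clm_apply hMp
  have hf : HasFDerivAt (fun z => σ * lift ηsl z) (σ • fderiv ℝ (lift ηsl) y) y :=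
    (((hη'.differentiable (by simp)) y).hasFDerivAt).const_mul σ
  have key := hf.fun_smul hu
  -- split the chain rule through the pair into its two partial derivatives
  have hD₂ := fderiv_mikadoLiftCL_comp_inr hV (T y) (n • (y + lift Dsl y))
  have hsplit : (fderiv ℝ M p).comp ((fderiv ℝ T y).prod (n • gradPhiCL Dsl y)) =
      (fderiv ℝ M p).comp ((ContinuousLinearMap.inl ℝ 𝕃 ℝ³).comp (fderiv ℝ T y)) +
        n • (fderiv ℝ (lift (V (matCL.symm (T y)))) (n • (y + lift Dsl y))).comp (gradPhiCL Dsl y) := by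
    ext1 v
    have e1 : (((fderiv ℝ T y) v, n • gradPhiCL Dsl y v) : 𝕃 × ℝ³) =
        ((fderiv ℝ T y) v, (0 : ℝ³)) + ((0 : 𝕃), n • gradPhiCL Dsl y v) := by
      rw [Prod.mk_add_mk, add_zero, zero_add]
    have e2 : ∀ w : ℝ³, (fderiv ℝ M p) ((0 : 𝕃), w) =
        fderiv ℝ (lift (V (matCL.symm (T y)))) (n • (y + lift Dsl y)) w := fun w => by
      rw [← hD₂]; rfl
    change (fderiv ℝ M p) ((fderiv ℝ T y) v, n • gradPhiCL Dsl y v) =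
      (fderiv ℝ M p) ((fderiv ℝ T y) v, 0) +
        n • fderiv ℝ (lift (V (matCL.symm (T y)))) (n • (y + lift Dsl y)) (gradPhiCL Dsl y v)
    rw [e1, map_add, e2, map_smul]
  refine HasFDerivAt.congr_fderiv key ?_
  rw [hsplit]
  simp only [fastDeriv, slowDeriv, hMdef, hTdef, hpdef, ContinuousLinearMap.comp_add,
    ContinuousLinearMap.comp_smul, ContinuousLinearMap.mul_def, ContinuousLinearMap.comp_assoc]
  module

/-- **The curl of the fast part**: `curl[fastDeriv] = n (ση) adj(∇Φ) (curl_ξ V)(R̃, ξ)` (the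
pull-back identity `curl(∇Φᵀ U∘Φ) = adj∇Φ (curl U)∘Φ` at the point, `BDSV.curlCLM_conj`).
[cite: BuckmasterEtAl2018, §5.3 (identity before (5.28))] -/
theorem curlCLM_fastDeriv (hV : ContDiff ℝ ∞ (mikadoLift V)) (y : ℝ³) :
    curlCLM (fastDeriv V σ c n ηsl Rsl Dsl y) =
      (n * (σ * lift ηsl y)) • Matrix.toEuclideanLin (liftGradPhi Dsl y).adjugate
        (curl (V (liftTildeR c Rsl Dsl y)) (proj (n • (y + lift Dsl y)))) := by
  rw [fastDeriv, map_smul, transposeCL_apply, matCL_symm_gradPhiCL, gradPhiCL_eq_matCL,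
    matCL_symm_stressCL, curlCLM_conj,
    curl_proj_eq ((isSmooth_of_mikadoLift hV _).isContDiff (by simp))]

/-! ### The size of the slow part, and its vanishing off the support of the cut-off -/

/-- **The slow part is small** (no factor `n`): if at the point `|η| ≤ 1`, `‖Dη‖ ≤ e₁`,
`‖D(lift D)‖ ≤ 1`, `‖D²(lift D)‖ ≤ d₂`, `‖DR̃‖ ≤ t₁`, and the Mikado lift and its derivative are
bounded by `C_V` at `(R̃, ξ)`, then `‖slowDeriv‖ ≤ σ ‖T‖ C_V (2t₁ + d₂ + 2e₁)` (`σ ≥ 0`,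
`T = transposeCL`). [cite: BuckmasterEtAl2018, Cor. 5.8 (5.30) and Prop. 5.7 (5.26)] -/
theorem norm_slowDeriv_le (hσ : 0 ≤ σ) {y : ℝ³} {e₁ d₂ t₁ CV : ℝ}
    (he0 : |lift ηsl y| ≤ 1) (he1 : ‖fderiv ℝ (lift ηsl) y‖ ≤ e₁)
    (hd1 : ‖fderiv ℝ (lift Dsl) y‖ ≤ 1) (hd2 : ‖fderiv ℝ (fderiv ℝ (lift Dsl)) y‖ ≤ d₂)
    (ht1 : ‖fderiv ℝ (stressCL c Rsl Dsl) y‖ ≤ t₁)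
    (hV0 : ‖mikadoLiftCL V (stressCL c Rsl Dsl y, n • (y + lift Dsl y))‖ ≤ CV)
    (hV1 : ‖fderiv ℝ (mikadoLiftCL V) (stressCL c Rsl Dsl y, n • (y + lift Dsl y))‖ ≤ CV) :
    ‖slowDeriv V σ c n ηsl Rsl Dsl y‖ ≤ σ * ‖transposeCL‖ * CV * (2 * t₁ + d₂ + 2 * e₁) := by
  set θ : ℝ := ‖transposeCL‖ with hθdef
  have hθ : 0 ≤ θ := norm_nonneg transposeCL
  have hCV : 0 ≤ CV := le_trans (norm_nonneg (mikadoLiftCL V _)) hV0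
  have ht0 : 0 ≤ t₁ := le_trans (norm_nonneg (fderiv ℝ (stressCL c Rsl Dsl) y)) ht1
  have he10 : 0 ≤ e₁ := le_trans (norm_nonneg (fderiv ℝ (lift ηsl) y)) he1
  have hd20 : 0 ≤ d₂ := le_trans (norm_nonneg (fderiv ℝ (fderiv ℝ (lift Dsl)) y)) hd2
  set G : 𝕃 := gradPhiCL Dsl y with hGdef
  set p : 𝕃 × ℝ³ := (stressCL c Rsl Dsl y, n • (y + lift Dsl y)) with hpdef
  -- `‖∇Φ‖ ≤ 2`, `‖∇Φᵀ‖ ≤ 2θ`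
  have hGn : ‖G‖ ≤ 2 := by
    rw [hGdef, gradPhiCL]
    refine (norm_add_le _ _).trans ?_
    have := ContinuousLinearMap.norm_id_le (𝕜 := ℝ) (E := ℝ³)
    rw [← ContinuousLinearMap.one_def] at this
    linarith
  have hAn : ‖transposeCL G‖ ≤ 2 * θ :=
    (transposeCL.le_opNorm G).trans (by rw [← hθdef, mul_comm]; exact mul_le_mul_of_nonneg_right hGn hθ)
  -- the three terms
  have h1 : ‖transposeCL G * (fderiv ℝ (mikadoLiftCL V) p).comp
      ((ContinuousLinearMap.inl ℝ 𝕃 ℝ³).comp (fderiv ℝ (stressCL c Rsl Dsl) y))‖ ≤ 2 * θ * (CV * t₁) := by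
    refine (norm_mul_le _ _).trans (mul_le_mul hAn ?_ (norm_nonneg _) (by positivity))
    refine (ContinuousLinearMap.opNorm_comp_le _ _).trans (mul_le_mul hV1 ?_ (norm_nonneg _) hCV)
    refine (ContinuousLinearMap.opNorm_comp_le _ _).trans ?_
    calc ‖ContinuousLinearMap.inl ℝ 𝕃 ℝ³‖ * ‖fderiv ℝ (stressCL c Rsl Dsl) y‖ ≤ 1 * t₁ :=
          mul_le_mul (ContinuousLinearMap.norm_inl_le_one ℝ 𝕃 ℝ³) ht1
            (norm_nonneg (fderiv ℝ (stressCL c Rsl Dsl) y)) zero_le_one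
      _ = t₁ := one_mul _
  have h2 : ‖(transposeCL.comp (fderiv ℝ (fderiv ℝ (lift Dsl)) y)).flip (mikadoLiftCL V p)‖ ≤
      θ * d₂ * CV := by
    refine (ContinuousLinearMap.le_opNorm _ _).trans ?_
    rw [ContinuousLinearMap.opNorm_flip]
    refine mul_le_mul ?_ hV0 (norm_nonneg _) (by positivity)
    exact (ContinuousLinearMap.opNorm_comp_le _ _).trans (mul_le_mul_of_nonneg_left hd2 hθ)
  have h3 : ‖(σ • fderiv ℝ (lift ηsl) y).smulRight (transposeCL G (mikadoLiftCL V p))‖ ≤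
      σ * e₁ * (2 * θ * CV) := by
    rw [ContinuousLinearMap.norm_smulRight_apply, norm_smul, Real.norm_eq_abs, abs_of_nonneg hσ]
    refine mul_le_mul (mul_le_mul_of_nonneg_left he1 hσ) ?_ (norm_nonneg _) (by positivity)
    exact ((transposeCL G).le_opNorm _).trans (mul_le_mul hAn hV0 (norm_nonneg _) (by positivity))
  have hf : ‖σ * lift ηsl y‖ ≤ σ := by
    rw [norm_mul, Real.norm_eq_abs, Real.norm_eq_abs, abs_of_nonneg hσ]
    exact (mul_le_mul_of_nonneg_left he0 hσ).trans (le_of_eq (mul_one σ))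
  rw [slowDeriv]
  calc _ ≤ ‖σ * lift ηsl y‖ * (2 * θ * (CV * t₁) + θ * d₂ * CV) + σ * e₁ * (2 * θ * CV) := by
        refine (norm_add_le _ _).trans (add_le_add ?_ h3)
        rw [norm_smul]
        exact mul_le_mul_of_nonneg_left ((norm_add_le _ _).trans (add_le_add h1 h2)) (norm_nonneg _)
    _ ≤ σ * (2 * θ * (CV * t₁) + θ * d₂ * CV) + σ * e₁ * (2 * θ * CV) :=
        add_le_add (mul_le_mul_of_nonneg_right hf (by positivity)) le_rfl
    _ = σ * ‖transposeCL‖ * CV * (2 * t₁ + d₂ + 2 * e₁) := by rw [← hθdef]; ring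

/-- Where the cut-off vanishes so does its derivative (`η ≥ 0` attains its minimum there). [folklore] -/
theorem fderiv_lift_eq_zero_of_nonneg (h0 : ∀ x, 0 ≤ ηsl x) {y : ℝ³} (hy : lift ηsl y = 0) :
    fderiv ℝ (lift ηsl) y = 0 := by
  have hmin : IsLocalMin (lift ηsl) y :=
    Filter.Eventually.of_forall fun z => by rw [hy]; exact h0 _
  exact hmin.fderiv_eq_zero

/-- **The slow part vanishes off the support of the cut-off**: if `η(y) = 0` and `Dη(y) = 0` then
`slowDeriv(y) = 0`. [folklore] -/
theorem slowDeriv_eq_zero {y : ℝ³} (hy : lift ηsl y = 0) (hy' : fderiv ℝ (lift ηsl) y = 0) :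
    slowDeriv V σ c n ηsl Rsl Dsl y = 0 := by
  rw [slowDeriv, hy, hy', mul_zero, zero_smul ℝ (A := 𝕃), smul_zero (A := ℝ³ →L[ℝ] ℝ), zero_add]
  ext1 v
  rw [ContinuousLinearMap.smulRight_apply, zero_apply, zero_apply,
    zero_smul ℝ (A := ℝ³)]

end Derivative

/-! ## On the torus: the curl of a potential summand, and the corrector `w_c` -/

section Torus

/-- The curl of a finite sum of `C¹` fields is the sum of the curls. [folklore] -/
theorem curl_finset_sum {ι : Type*} (s : Finset ι) {f : ι → 𝕋³ → ℝ³}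
    (hf : ∀ i ∈ s, IsContDiff 1 (f i)) (x : 𝕋³) :
    curl (fun z => ∑ i ∈ s, f i z) x = ∑ i ∈ s, curl (f i) x := by
  obtain ⟨y, rfl⟩ := proj_surjective x
  have hlift : (lift fun z => ∑ i ∈ s, f i z) = fun y => ∑ i ∈ s, lift (f i) y := rfl
  have hsum : IsContDiff 1 (fun z => ∑ i ∈ s, f i z) := by
    change ContDiff ℝ 1 (lift fun z => ∑ i ∈ s, f i z)
    rw [hlift]
    exact ContDiff.sum fun i hi => hf i hi
  have hderiv : HasFDerivAt (lift fun z => ∑ i ∈ s, f i z) (∑ i ∈ s, fderiv ℝ (lift (f i)) y) y := by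
    rw [hlift]
    exact HasFDerivAt.fun_sum fun i hi => (((hf i hi).differentiable one_ne_zero) y).hasFDerivAt
  rw [curl_proj_eq hsum, hderiv.fderiv, map_sum]
  exact Finset.sum_congr rfl fun i hi => (curl_proj_eq (hf i hi) y).symm

variable (P : Params) (S : Setting)

/-- **The slow part of `D(lift(i-th summand of Z(t)))`** at `y ∈ ℝ³`, for the construction data of
§5 (`σ = (ρ_q/∑∫η_j²)^{1/2}`, `c = ∑∫η_j²/ρ_q`, `n = n_{q+1}`): the vector field whose curl is
`n · (i-th summand of w_c)` (`BDSV.correctorPart_proj`). [cite: BuckmasterEtAl2018, §5.3 (5.27)] -/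
def slowPart (𝔚 : MikadoDatum mikadoRadius) (η : ℕ → ℝ → 𝕋³ → ℝ) (D : ℕ → ℝ → 𝕋³ → ℝ³)
    (i : ℕ) (t : ℝ) (y : ℝ³) : 𝕃 :=
  slowDeriv 𝔚.V (Real.sqrt (rhoQ P S t / etaMass P S η t)) (etaMass P S η t / rhoQ P S t)
    (P.freqNat (S.q + 1)) (η i t) (S.Rbar t) (D i t) y

variable {P S} {𝔚 : MikadoDatum mikadoRadius} {η : ℕ → ℝ → 𝕋³ → ℝ} {D : ℕ → ℝ → 𝕋³ → ℝ³}
  {i : ℕ} {t : ℝ}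

/-- The lift of the `i`-th potential summand is the carrier-form summand `BDSV.summandCL`. [folklore] -/
theorem lift_potentialSummand_eq_summandCL (hD : IsContDiff 1 (D i t)) :
    lift (potentialSummand P S 𝔚 η D i t) =
      summandCL 𝔚.V (Real.sqrt (rhoQ P S t / etaMass P S η t)) (etaMass P S η t / rhoQ P S t)
        (P.freqNat (S.q + 1)) (η i t) (S.Rbar t) (D i t) := by
  rw [lift_potentialSummand hD, liftSummand_eq_summandCL]

/-- The `i`-th potential summand is a smooth field for smooth slices `ηᵢ(t)`, `R̊̄_q(t)`, `Dᵢ(t)`. [folklore] -/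
theorem isSmooth_potentialSummand (hη : IsSmooth (η i t)) (hR : IsSmooth (S.Rbar t))
    (hD : IsSmooth (D i t)) : IsSmooth (potentialSummand P S 𝔚 η D i t) := by
  change ContDiff ℝ ∞ (lift (potentialSummand P S 𝔚 η D i t))
  rw [lift_potentialSummand_eq_summandCL (hD.isContDiff (by simp))]
  exact contDiff_summandCL 𝔚.contDiff_mikadoLift_V _ _ _ hη hR hD

/-- **The curl of a potential summand** (the content of "one can check that `w_{q+1} = w_o + w_c`",
(5.28), summand by summand): for smooth slices and symmetric `R̊̄_q(t)`, at every point `x = proj y`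
at which `R̃_{q,i}(x)` lies in the Mikado ball whenever `ηᵢ(x) ≠ 0` (Lemma 5.4),
`curl(ρ_{q,i}^{1/2} ∇Φᵢᵀ V(R̃_{q,i}, nΦᵢ))(x) = n · ρ_{q,i}^{1/2} adj(∇Φᵢ) W(R̃_{q,i}, nΦᵢ)(x) + curl[slow partᵢ(y)]`
(`curl_ξ V = W`, (5.9)). [cite: BuckmasterEtAl2018, §5.3 (5.20), (5.27)–(5.28)] -/
theorem curl_potentialSummand_proj (hη : IsSmooth (η i t)) (hR : IsSmooth (S.Rbar t))
    (hD : IsSmooth (D i t)) (hsymm : ∀ x, ∀ a b : Fin 3, S.Rbar t x a b = S.Rbar t x b a) {y : ℝ³}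
    (hball : η i t (proj y) ≠ 0 →
      tildeR P S η D i t (proj y) ∈ Metric.closedBall (1 : 𝕄) mikadoRadius) :
    curl (potentialSummand P S 𝔚 η D i t) (proj y) =
      (P.freqNat (S.q + 1) : ℝ) •
          (sqrtRhoI P S η i t (proj y) •
            Matrix.toEuclideanLin (gradPhi D i t (proj y)).adjugate
              (𝔚.W (tildeR P S η D i t (proj y)) (P.freqNat (S.q + 1) • phiPoint D i t (proj y)))) +
        curlCLM (slowPart P S 𝔚 η D i t y) := by
  have hD1 : IsContDiff 1 (D i t) := hD.isContDiff (by simp)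
  have hC1 : IsContDiff 1 (potentialSummand P S 𝔚 η D i t) :=
    (isSmooth_potentialSummand hη hR hD).isContDiff (by simp)
  have hG : liftGradPhi (D i t) y = gradPhi D i t (proj y) := by
    have h := congrFun (lift_gradPhi (D := D) (i := i) (t := t) hD1) y
    rw [lift_apply] at h
    exact h.symm
  have hT : liftTildeR (etaMass P S η t / rhoQ P S t) (S.Rbar t) (D i t) y =
      tildeR P S η D i t (proj y) := by
    have h := congrFun (lift_tildeR (P := P) (S := S) (η := η) (D := D) (i := i) (t := t) hD1) y
    rw [lift_apply] at h
    exact h.symm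
  have hξ : proj ((P.freqNat (S.q + 1) : ℝ) • (y + lift (D i t) y)) =
      P.freqNat (S.q + 1) • phiPoint D i t (proj y) := by
    rw [Nat.cast_smul_eq_nsmul, proj_nsmul, proj_add, phiPoint, lift_apply]
  rw [curl_proj_eq hC1, lift_potentialSummand_eq_summandCL hD1,
    (hasFDerivAt_summandCL 𝔚.contDiff_mikadoLift_V hη hR hD y).fderiv, map_add,
    curlCLM_fastDeriv 𝔚.contDiff_mikadoLift_V, hG, hT, hξ, slowPart]
  congr 1
  by_cases hne : η i t (proj y) = 0
  · rw [lift_apply, hne, mul_zero, mul_zero, zero_smul ℝ (A := ℝ³), sqrtRhoI, hne, zero_mul,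
      zero_smul ℝ (A := ℝ³), smul_zero (A := ℝ³)]
  · rw [𝔚.curl_V _ (hball hne) (isSymm_tildeR (hsymm (proj y)) i), sqrtRhoI, lift_apply, smul_smul,
      mul_comm (η i t (proj y))]

/-- **The corrector through the slow parts** (the tree's form of (5.27)): for smooth slices,
symmetric `R̊̄_q(t)`, `n_{q+1} ≠ 0`, and `R̃_{q,i}` in the Mikado ball on `supp ηᵢ(t)`,
`w_c(x, t) = n⁻¹ ∑ᵢ curl[slow partᵢ(y)]` at `x = proj y` (the fast parts of `n⁻¹ curl Z` sum to
`w_o`). [cite: BuckmasterEtAl2018, §5.3 (5.27)–(5.28)] -/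
theorem correctorPart_proj (hη : ∀ i, IsSmooth (η i t)) (hR : IsSmooth (S.Rbar t))
    (hD : ∀ i, IsSmooth (D i t)) (hsymm : ∀ x, ∀ a b : Fin 3, S.Rbar t x a b = S.Rbar t x b a)
    (hn : P.freqNat (S.q + 1) ≠ 0) {y : ℝ³}
    (hball : ∀ i, η i t (proj y) ≠ 0 →
      tildeR P S η D i t (proj y) ∈ Metric.closedBall (1 : 𝕄) mikadoRadius) :
    correctorPart P S 𝔚 η D t (proj y) =
      ((P.freqNat (S.q + 1) : ℝ))⁻¹ •
        ∑ i ∈ Finset.range (cutoffCount S.T (P.τ S.q)), curlCLM (slowPart P S 𝔚 η D i t y) := by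
  have hn' : (P.freqNat (S.q + 1) : ℝ) ≠ 0 := Nat.cast_ne_zero.2 hn
  have hcurl : curl (potential P S 𝔚 η D t) (proj y) =
      ∑ i ∈ Finset.range (cutoffCount S.T (P.τ S.q)), curl (potentialSummand P S 𝔚 η D i t) (proj y) :=
    curl_finset_sum _ (fun i _ => (isSmooth_potentialSummand (hη i) hR (hD i)).isContDiff (by simp)) _
  rw [correctorPart, perturbation, principalPart, hcurl,
    Finset.sum_congr rfl fun i _ => curl_potentialSummand_proj (hη i) hR (hD i) hsymm (hball i),
    Finset.sum_add_distrib, smul_add, ← Finset.smul_sum, smul_smul, inv_mul_cancel₀ hn', one_smul,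
    add_sub_cancel_left]

end Torus

end BDSV

end Literature.Analysis.FluidPDE
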